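import Summits.Ventures.CertifiedManyBodySolver.Certificates.HubbardTTPrime_freeGC_kernelQuadrature_b3o2_strip_halfFilling
import Summits.Ventures.CertifiedManyBodySolver.Certificates.HubbardSquare_n1_tpm5o16_tpm3o16_U15o2_thermal_C1nodesTT_stair221_j318145_j318146
import Literature.MathematicalPhysics.QuantumLattice.HubbardTTPrimeThermalPressureCellRule
import HarnessLib
import HarnessLib.Audit

/-!
# Ventures/CertifiedManyBodySolver — Observables/PhaseSeparationExclusionBoxThermalHotInterp.lean: the `U`-CONVEXITY TRANSPORT of the dense partner's hot anchor —
# free gas at `U = 0` (kernel) ↔ hubbard-thermal-eng-4's staircase-Markov ceiling at `U = 15/2` («THE ELECTRON-SIDE ROWS ON THE HOLE STRIP», hubbard-downfold-unc-2 g33)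

HONEST FRAMING: first certified bounds; not a superconductivity verdict. CLASS = DERIVED / CONTEXT (a thermal-anchor transport lemma + two strip instances; zero compute
beyond the kernel quadrature of the imported certificate file; no definition, no `sorry`).
THE POINT: every `T > 0` competing-order word of this seat carries a HOT ANCHOR for the dense partner, `p(β_h; 1, s, U; 1) ≤ π` on the cell. hubbard-thermal-eng-4's
`n = 1`-tuned LSCO-corner ceilings (`lscoCorners_hotCap_n1_b{3o2,2,3}_on_cell_j318145_j318146`, p704865) hold for `U ≥ 15/2` only (the canonical pressure is ANTITONE in
`U`), so the La₂₋ₓSrₓCuO₄ box (`U/t` from 5.9) kept the a-priori / Mott anchor on its binding cells `[59/10, 6]`, `[6, 8]`. But the canonical pressure is also CONVEX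
in `U` (`pressureTT'_le_convexComb_U`, `Literature/…/HubbardTTPrimeThermalPressureCellRule.lean`; the log of a sector partition function is convex in a linear coupling):
on `U ∈ [0, 15/2]` it lies BELOW the chord between the FREE canonical pressure at `U = 0` — bounded in the KERNEL through the free grand-canonical pressure
(`Certificates/HubbardTTPrime_freeGC_kernelQuadrature_b3o2_strip_halfFilling.lean`, this seat g33: `A(−3/10∣−1/4∣−1/5) = 2.887934 ∣ 2.872454 ∣ 2.8599685` at
`β_h = 3/2`) — and eng-4's `π(3/2) = 1.3610895` at `U = 15/2`. `hotCap_interpU_on_cell`: with the CORNER RULE (`pressureTT'_le_on_cell_of_corners`, joint convexity in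
the `β`-scaled couplings) a cell `[s₁, s₂] × [U₁, U₂] ⊂ [−5/16, −3/16] × [0, 15/2]` carries the constant anchor `V = max over corners of (1 − u/7.5)·A_j + (u/7.5)·π` (the
maximum sits at `u = U₁`: `V ≈ 1.687` at `U₁ = 59/10`, `1.667` at `U₁ = 6`). In the `β_h = 3/2` bookkeeping of `psT_not_thermal_mix_on_cell_of_columns_hotAnchorSS_tcap` the
dense term of the threshold numerator on the La-214 binding cells becomes `b·(V + (3/2)·L(s)) ≈ 0.36` instead of the Mott `b·(C₀ + C₁(L − G)) ≈ 0.77` ⇒ `(≤ 2/5 ∣ ≥ 1)`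
on the whole La214E box `∀β·t ≥ 14 → ≈ 8` (`Observables/PhaseSeparationExclusionNearStripESHotI*`, this session).
WHAT THIS IS NOT: a certificate or number of record; the instances are conditional BY NAME on the two Markov claim nodes `cert_feC1tt_stair221_tpm{5o16,3o16}_U15o2_n1_b3o2_j31814{5,6}`
(CONTROL inputs, exactly as in `…MidSegmentCapThermalLa214Tuned.lean`); the free end is a kernel theorem (no node); no phase / `T_c` sentence.

Seat hubbard-downfold-unc-2 g33 (`prover-hubbard-downfold-unc-2-g33-0`), 2026-08-29.
References: [Israel1979] Thm I.3.4 (convexity of the pressure); [Ruelle1969] §3.4; [PoulinHastings2011] eqs. (3)–(8) (the Markov certificates' method).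
-/

noncomputable section

namespace Summit.Ventures.CertifiedManyBodySolver.Observables

open Summit.Ventures.CertifiedManyBodySolver.Certificates
open Literature.MathematicalPhysics.QuantumLattice Literature.MathematicalPhysics.QuantumLattice.ThermodynamicLimit
open Literature.MathematicalPhysics.QuantumLattice.InfVolFermionState Set Filter

/-- **`U`-convexity transport of a hot anchor onto a cell.** Half filling, `β_h ≥ 0`, a cell `[s₁, s₂] × [U₁, U₂]` with `0 ≤ U₁ ≤ U₂ ≤ U_h`, `U_h > 0`:
free-end ceilings `p(β_h; 1, s_j, 0; 1) ≤ A_j` and far-end ceilings `p(β_h; 1, s_j, U_h; 1) ≤ π` at the two `t′`-ends give `p(β_h; 1, s, U; 1) ≤ V` on the whole cell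
for any `V` dominating the four corner chords `(1 − u/U_h)·A_j + (u/U_h)·π`, `u ∈ {U₁, U₂}` (Jensen in `U` at each corner — `pressureTT'_le_convexComb_U` — then the
corner rule `pressureTT'_le_on_cell_of_corners`). [cite: Israel1979, Thm. I.3.4] -/
theorem hotCap_interpU_on_cell {βh : ℝ} (hβh : 0 ≤ βh) {s₁ s₂ U₁ U₂ Uh A₁ A₂ π V : ℝ}
    (hU₁ : 0 ≤ U₁) (h12 : U₁ ≤ U₂) (h2h : U₂ ≤ Uh) (hUh : 0 < Uh)
    (hA₁ : pressureTT' βh 1 s₁ 0 1 ≤ A₁) (hA₂ : pressureTT' βh 1 s₂ 0 1 ≤ A₂)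
    (hπ₁ : pressureTT' βh 1 s₁ Uh 1 ≤ π) (hπ₂ : pressureTT' βh 1 s₂ Uh 1 ≤ π)
    (hV : ∀ A ∈ ({A₁, A₂} : Set ℝ), ∀ u ∈ ({U₁, U₂} : Set ℝ), (1 - u / Uh) * A + (u / Uh) * π ≤ V) :
    ∀ s ∈ Icc s₁ s₂, ∀ U ∈ Icc U₁ U₂, pressureTT' βh 1 s U 1 ≤ V := by
  have corner : ∀ s' A, pressureTT' βh 1 s' 0 1 ≤ A → pressureTT' βh 1 s' Uh 1 ≤ π → A ∈ ({A₁, A₂} : Set ℝ) →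
      ∀ u ∈ ({U₁, U₂} : Set ℝ), pressureTT' βh 1 s' u 1 ≤ V := by
    intro s' A hA hπ hAm u hu
    have hu' : u = U₁ ∨ u = U₂ := by simpa using hu
    have hu0 : 0 ≤ u := by rcases hu' with h | h <;> rw [h] <;> linarith
    have huh : u ≤ Uh := by rcases hu' with h | h <;> rw [h] <;> linarith
    have hm : 0 ≤ u / Uh := div_nonneg hu0 hUh.le
    have hm1 : u / Uh ≤ 1 := (div_le_one hUh).2 huh
    have hl : 0 ≤ 1 - u / Uh := sub_nonneg.2 hm1
    have hcomb : (1 - u / Uh) * 0 + (u / Uh) * Uh = u := by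
      rw [mul_zero, zero_add, div_mul_cancel₀ u hUh.ne']
    have hJ := pressureTT'_le_convexComb_U (n := 1) (by norm_num) (by norm_num) hβh 1 s' (U₁ := 0) (U₂ := Uh) (U := u)
      (l := 1 - u / Uh) (m := u / Uh) le_rfl hUh.le hl hm (by ring) hcomb
    calc pressureTT' βh 1 s' u 1
        ≤ (1 - u / Uh) * pressureTT' βh 1 s' 0 1 + (u / Uh) * pressureTT' βh 1 s' Uh 1 := hJ
      _ ≤ (1 - u / Uh) * A + (u / Uh) * π :=
          add_le_add (mul_le_mul_of_nonneg_left hA hl) (mul_le_mul_of_nonneg_left hπ hm)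
      _ ≤ V := hV A hAm u hu
  intro s hs U hU
  refine pressureTT'_le_on_cell_of_corners (n := 1) (by norm_num) (by norm_num) hβh hU₁ 1 (β₂ := βh) (s₁ := s₁) (s₂ := s₂)
    (U₂ := U₂) (V := V) ?_ βh ⟨le_rfl, le_rfl⟩ s hs U hU
  intro b hb s' hs' u hu
  have hb' : b = βh := by simpa using hb
  subst hb'
  rcases (show s' = s₁ ∨ s' = s₂ by simpa using hs') with h | h
  · rw [h]; exact corner s₁ A₁ hA₁ hπ₁ (by simp) u hu
  · rw [h]; exact corner s₂ A₂ hA₂ hπ₂ (by simp) u hu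

/-! ## Strip instances at `β_h = 3/2` (free end: this seat's kernel quadrature; far end: hubbard-thermal-eng-4's LSCO-corner ceiling at `U = 15/2`) -/

/-- **STRIP INSTANCE, segment D `t′ ∈ [-3/10, -1/4]`, `β_h = 3/2`**: for `0 ≤ U₁ ≤ U₂ ≤ 15/2` and any `V` dominating the four corner chords
`(1 − u/7.5)·A_j + (u/7.5)·π` (`u ∈ {U₁, U₂}`, `A_j` = the free hot anchors `freeHotCap_b3o2_tpm3o10_n1` / `_tpm1o4_n1` = `2.8879340` / `2.8724540`,
`π = 1.3610895…` = hubbard-thermal-eng-4's LSCO-corner ceiling `lscoCorners_hotCap_n1_b3o2_on_cell_j318145_j318146` read at `U = 15/2`):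
`p(3/2; 1, s, U; 1) ≤ V` on `[-3/10, -1/4] × [U₁, U₂]` — the input shape of `psT_/psHT_/psGCT_…_hotAnchorSS_tcap` (`βh₂ := 3/2`). [cite: Israel1979, Thm. I.3.4] [cite: PoulinHastings2011, eqs. (3)–(8)] -/
theorem stripHotCap_b3o2_interpU_on_cell_D (hL : cert_feC1tt_stair221_tpm5o16_U15o2_n1_b3o2_j318145)
    (hR : cert_feC1tt_stair221_tpm3o16_U15o2_n1_b3o2_j318146) {U₁ U₂ V : ℝ} (hU₁ : 0 ≤ U₁) (h12 : U₁ ≤ U₂) (h2h : U₂ ≤ 15 / 2)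
    (hV : ∀ A ∈ ({((1443967/500000 : ℚ) : ℝ), ((1436227/500000 : ℚ) : ℝ)} : Set ℝ), ∀ u ∈ ({U₁, U₂} : Set ℝ),
      (1 - u / (15 / 2)) * A + (u / (15 / 2)) * (6129802219691269 / 4503599627370496 : ℝ) ≤ V) :
    ∀ s ∈ Icc (-3 / 10 : ℝ) (-1 / 4), ∀ U ∈ Icc U₁ U₂, pressureTT' (3 / 2 : ℝ) 1 s U 1 ≤ V := by
  have hπ := lscoCorners_hotCap_n1_b3o2_on_cell_j318145_j318146 hL hR (s₁ := -3 / 10) (s₂ := -1 / 4) (U₁ := 15 / 2) (U₂ := 15 / 2)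
    (by norm_num) (by norm_num) (by norm_num)
  exact hotCap_interpU_on_cell (βh := 3 / 2) (by norm_num) hU₁ h12 h2h (by norm_num)
    (freeHotCap_b3o2_tpm3o10_n1 le_rfl) (freeHotCap_b3o2_tpm1o4_n1 le_rfl)
    (hπ (-3 / 10) ⟨le_rfl, by norm_num⟩ (15 / 2) ⟨le_rfl, le_rfl⟩) (hπ (-1 / 4) ⟨by norm_num, le_rfl⟩ (15 / 2) ⟨le_rfl, le_rfl⟩) hV

/-- **STRIP INSTANCE, segment Q `t′ ∈ [-1/4, -1/5]`, `β_h = 3/2`**: for `0 ≤ U₁ ≤ U₂ ≤ 15/2` and any `V` dominating the four corner chords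
`(1 − u/7.5)·A_j + (u/7.5)·π` (`u ∈ {U₁, U₂}`, `A_j` = the free hot anchors `freeHotCap_b3o2_tpm1o4_n1` / `_tpm1o5_n1` = `2.8724540` / `2.8599690`,
`π = 1.3610895…` = hubbard-thermal-eng-4's LSCO-corner ceiling `lscoCorners_hotCap_n1_b3o2_on_cell_j318145_j318146` read at `U = 15/2`):
`p(3/2; 1, s, U; 1) ≤ V` on `[-1/4, -1/5] × [U₁, U₂]` — the input shape of `psT_/psHT_/psGCT_…_hotAnchorSS_tcap` (`βh₂ := 3/2`). [cite: Israel1979, Thm. I.3.4] [cite: PoulinHastings2011, eqs. (3)–(8)] -/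
theorem stripHotCap_b3o2_interpU_on_cell_Q (hL : cert_feC1tt_stair221_tpm5o16_U15o2_n1_b3o2_j318145)
    (hR : cert_feC1tt_stair221_tpm3o16_U15o2_n1_b3o2_j318146) {U₁ U₂ V : ℝ} (hU₁ : 0 ≤ U₁) (h12 : U₁ ≤ U₂) (h2h : U₂ ≤ 15 / 2)
    (hV : ∀ A ∈ ({((1436227/500000 : ℚ) : ℝ), ((2859969/1000000 : ℚ) : ℝ)} : Set ℝ), ∀ u ∈ ({U₁, U₂} : Set ℝ),
      (1 - u / (15 / 2)) * A + (u / (15 / 2)) * (6129802219691269 / 4503599627370496 : ℝ) ≤ V) :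
    ∀ s ∈ Icc (-1 / 4 : ℝ) (-1 / 5), ∀ U ∈ Icc U₁ U₂, pressureTT' (3 / 2 : ℝ) 1 s U 1 ≤ V := by
  have hπ := lscoCorners_hotCap_n1_b3o2_on_cell_j318145_j318146 hL hR (s₁ := -1 / 4) (s₂ := -1 / 5) (U₁ := 15 / 2) (U₂ := 15 / 2)
    (by norm_num) (by norm_num) (by norm_num)
  exact hotCap_interpU_on_cell (βh := 3 / 2) (by norm_num) hU₁ h12 h2h (by norm_num)
    (freeHotCap_b3o2_tpm1o4_n1 le_rfl) (freeHotCap_b3o2_tpm1o5_n1 le_rfl)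
    (hπ (-1 / 4) ⟨le_rfl, by norm_num⟩ (15 / 2) ⟨le_rfl, le_rfl⟩) (hπ (-1 / 5) ⟨by norm_num, le_rfl⟩ (15 / 2) ⟨le_rfl, le_rfl⟩) hV

end Summit.Ventures.CertifiedManyBodySolver.Observables

end
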